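import Summits.Ventures.HodgeRepro.FaceCensusRows8
import Summits.Ventures.HodgeRepro.FaceCensusRows12
import Summits.Ventures.HodgeRepro.BallModel

/-!
# Three kernel statements about CM abelian varieties, rank-four Weil faces and Picard modular surfaces

This statement set is SELF-CONTAINED on Mathlib: it states three propositions, `RankFourFaceCensus`, `MuTable` and
`HeckeTranslateWedge`, as closed `def … : Prop` terms, together with the minimal definitions they need (this file and its
three sibling modules `FaceCensusEngine`, `FaceCensusRows8` / `FaceCensusRows12`, `BallModel` in this directory, which import
only Mathlib).  Nothing is
proved or asserted here; in particular nothing in this file says anything about the status of the Hodge conjecture for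
CM abelian varieties, which is NOT proved.

## Background (published literature only)

* A CM field `F` is a totally imaginary quadratic extension of a totally real field; complex conjugation induces a
  well-defined central involution `c` of `Gal(F̃/ℚ)`.  A CM type of `F` is a set `Φ` of embeddings `F → ℂ` containing
  exactly one of each conjugate pair; `(F, Φ)` determines an isogeny class of abelian varieties `A_Φ` with complex
  multiplication (Shimura–Taniyama).  For GALOIS `F` with group `G` and a fixed embedding, `Hom(F, ℂ) ≅ G` and a CM type is
  a subset `T ⊆ G` with `T ⊔ cT = G`; the Galois twists act by right translation.  Hodge classes on `A_Φ` and on products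
  of such varieties are governed by combinatorics of types (Pohlmann, Ann. of Math. 88 (1968), Thm. 1; Deligne, *Hodge
  cycles on abelian varieties*, LNM 900 (1982); André; Moonen–Zarhin, Duke Math. J. 77 (1995) and Math. Ann. 315 (1999)),
  and the classes that are not generated by divisors are organised by WEIL classes `⋀^{2d}_K H¹` of abelian varieties
  of Weil type (Weil 1977; van Geemen's surveys; Moonen–Zarhin).  Section A below is a finite census, for Galois CM fields
  of degree `6`, `8`, `12`, of the "rank-four faces": quadruples of CM types `(Φ; π, π′)` obtained from one type by
  flipping it at two infinite places, whose four "corners" carry a Weil-type line of Hodge type `(2,2)`.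
* Picard modular surfaces are the ball quotients `Γ \ 𝔹²` attached to unitary groups `U(2,1)` of hermitian forms in
  three variables over a CM field; their cohomology is studied through theta correspondences for unitary dual pairs
  (Kudla–Millson; Gelbart–Rogawski, *L-functions and Fourier–Jacobi coefficients for the unitary group U(3)*, Invent.
  Math. 105 (1991)) and through Hecke correspondences (Clozel, J. reine angew. Math. 444 (1993); Venkataramana,
  Compositio Math. 125 (2001), Thm. 8).  Section B is the integer bookkeeping of archimedean types attached to a
  "seesaw" of four hermitian lines over a CM field; Section C is the pointwise core of the non-vanishing of the wedge of a
  Hecke translate of a holomorphic one-form against another one on the ball.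

All docstrings describe the intended meaning; the formal content is exactly the displayed terms.
-/

set_option autoImplicit false

namespace Summit.Ventures.HodgeRepro

/-! ## A.  The rank-four face census for Galois CM fields of degree 6, 8 and 12

The finite model `(G, c)`, its engine and the eleven census rows are in `FaceCensusEngine.lean`, `FaceCensusRows8.lean`,
`FaceCensusRows12.lean`; here the degree-`6` coordinate census and the conjunction `RankFourFaceCensus`. -/

namespace FaceCensus

/-! ### A.3  Degree 6 in coordinates: the cyclic sextic CM field, its `k`-induced corner and the Weil plane of `B × E`

For a Galois CM field `F` of degree `6` the group is `G = ℤ/6 = ⟨σ⟩`, `c = σ³`, and `k = F^{⟨σ²⟩}` is the imaginary quadratic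
subfield.  Embeddings `≅ ℤ/6`; a CM type is a `3`-subset `T ⊂ ℤ/6` containing exactly one of `i, i + 3`; twisting is `T ↦ T + m`;
`T` is INDUCED from `k` iff `T + 2 = T` (then `A_T ~ E³`, `E` the CM elliptic curve of `k`), otherwise `T` is primitive and `A_T` is a
twist of ONE simple CM threefold `B` (the primitive types form a single translation orbit).  The three places are `{i, i+3}`; the
corners of the face `(Φ; π, π′)` are `Φ, (Φ̄)^{(π)}, (Φ̄)^{(π′)}, Φ^{(ππ′)}` with `Φ̄ = Φ + 3`, `T^{(π)} = T ∆ {π, π+3}`.  The census says: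
every face has exactly ONE `k`-induced corner and its three primitive corners form a full packet `{Ψ, Ψ+2, Ψ+4}`, so the corner
product is isogenous to `B³ × E³` and the face Weil line lives on the CM fourfold `Y = B × E`; and Pohlmann's criterion
(Ann. of Math. 88 (1968), Thm. 1) for `Y` with `B` of type `{0,1,2}` and `E` of the `k`-type `{odd}` gives `dim B¹ = 4`, `dim B² = 8`
with exactly two exceptional `4`-sets `{0,2,4} ⊔ {e₀}`, `{1,3,5} ⊔ {e₁}` — the two eigen-generators of the `k`-Weil plane
`⋀⁴_k H¹(B × E)` of the Weil-type fourfold `(B × E, k)` (Moonen–Zarhin, Math. Ann. 315 (1999), Introduction). -/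

namespace Sextic.Coordinates

open Finset

/-- `T ⊂ ℤ/6` is a CM type (exactly one of `i`, `i + 3`). -/
def isCMType (T : Finset (ZMod 6)) : Bool := decide (∀ i : ZMod 6, (i ∈ T ↔ i + 3 ∉ T))

/-- The eight CM types of the cyclic sextic field. -/
def cmTypes : Finset (Finset (ZMod 6)) := (univ : Finset (ZMod 6)).powersetCard 3 |>.filter fun T => isCMType T = true

/-- Conjugate type `T̄ = T + 3`. -/
def bar (T : Finset (ZMod 6)) : Finset (ZMod 6) := T.image fun i => i + 3

/-- Flip at the place `{p, p+3}`: `T ∆ {p, p+3}`. -/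
def flip (p : ZMod 6) (T : Finset (ZMod 6)) : Finset (ZMod 6) := symmDiff T {p, p + 3}

/-- The four corners of the face `(Φ; π, π′)`: `Φ, flip_π Φ̄, flip_π′ Φ̄, flip_π′ (flip_π Φ)`. -/
def corners (Φ : Finset (ZMod 6)) (p p' : ZMod 6) : List (Finset (ZMod 6)) :=
  [Φ, flip p (bar Φ), flip p' (bar Φ), flip p' (flip p Φ)]

/-- The faces: a CM type and two distinct places (`p, p′ ∈ {0,1,2}`, `p ≠ p′`). -/
def faces : Finset (Finset (ZMod 6) × ZMod 6 × ZMod 6) :=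
  (cmTypes ×ˢ (({0, 1, 2} : Finset (ZMod 6)) ×ˢ ({0, 1, 2} : Finset (ZMod 6)))).filter fun f => f.2.1 ≠ f.2.2

/-- `T` is induced from the quadratic subfield `k = F^{⟨σ²⟩}` (`T + 2 = T`). -/
def isInduced (T : Finset (ZMod 6)) : Bool := decide (T.image (fun i => i + 2) = T)

/-- Points `Hom(F, ℂ) ⊔ Hom(k, ℂ) = ℤ/6 ⊔ ℤ/2` (restriction `ℤ/6 → ℤ/2` is reduction mod `2`, `Gal(F/k) = ⟨2⟩`). -/
abbrev Pt : Type := ZMod 6 ⊕ ZMod 2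

/-- Galois action of `σᵍ`: `i ↦ i + g` on both blocks. -/
def act (g : ZMod 6) : Pt → Pt
  | Sum.inl i => Sum.inl (i + g)
  | Sum.inr j => Sum.inr (j + (g.val : ZMod 2))

/-- CM type of `Y = B × E`: `B` of type `{0,1,2}`, `E` of type `{1} ⊂ ℤ/2`. -/
def phi : Finset Pt := {Sum.inl 0, Sum.inl 1, Sum.inl 2, Sum.inr 1}

/-- Pohlmann's condition with multiplicity `m`: `|P ∩ g⁻¹Φ| = m` for every `g`. -/
def eq32 (m : ℕ) (P : Finset Pt) : Bool := decide (∀ g : ZMod 6, (P.filter fun x => act g x ∈ phi).card = m)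

/-- Pohlmann `4`-sets of `B × E` (a basis of the Hodge classes `B²(B × E) ⊗ ℚ̄`). -/
def hodgeSets : Finset (Finset Pt) := ((univ : Finset Pt).powersetCard 4).filter fun P => eq32 2 P = true

/-- Pohlmann `2`-sets (a basis of `B¹`, the divisor classes). -/
def divisorSets : Finset (Finset Pt) := ((univ : Finset Pt).powersetCard 2).filter fun P => eq32 1 P = true

/-- **Degree-6 census in coordinates.** (1) `8` CM types and `48` faces; `2` types are `k`-induced (`{0,2,4}`, `{1,3,5}`), the `6`
primitive ones form ONE translation orbit of `{0,1,2}`.  (2) `SumTwo`: for every face and every embedding `i`, exactly two of the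
four corners contain `i`.  (3) Corner structure: the four corners are pairwise distinct CM types, exactly one is `k`-induced, and the
three primitive ones form a full packet `{Ψ, Ψ+2, Ψ+4}`.  (4) Pohlmann census of `Y = B × E`: `B¹ = 4`, `B² = 8`, and the Pohlmann
`4`-sets NOT stable under `c = σ³` are exactly `{σ⁰,σ²,σ⁴} ⊔ {e₀}` and `{σ¹,σ³,σ⁵} ⊔ {e₁}` (the Weil plane of `(B × E, k)`). -/
def Census : Prop :=
  (cmTypes.card = 8 ∧ faces.card = 48 ∧ (cmTypes.filter fun T => isInduced T = true) = { {0, 2, 4}, {1, 3, 5} } ∧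
    (∀ T ∈ cmTypes, isInduced T = false → ∃ m : ZMod 6, T = ({0, 1, 2} : Finset (ZMod 6)).image fun i => i + m)) ∧
  (∀ f ∈ faces, ∀ i : ZMod 6, ((corners f.1 f.2.1 f.2.2).filter fun T => i ∈ T).length = 2) ∧
  (∀ f ∈ faces,
    (corners f.1 f.2.1 f.2.2).Nodup ∧ (∀ T ∈ corners f.1 f.2.1 f.2.2, T ∈ cmTypes) ∧
    ((corners f.1 f.2.1 f.2.2).filter fun T => isInduced T = true).length = 1 ∧
    (∃ Ψ ∈ corners f.1 f.2.1 f.2.2, isInduced Ψ = false ∧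
      Ψ.image (fun i => i + 2) ∈ corners f.1 f.2.1 f.2.2 ∧ Ψ.image (fun i => i + 4) ∈ corners f.1 f.2.1 f.2.2)) ∧
  (divisorSets.card = 4 ∧ hodgeSets.card = 8 ∧
    (hodgeSets.filter fun P => ∃ x ∈ P, act 3 x ∉ P) =
      { {Sum.inl 0, Sum.inl 2, Sum.inl 4, Sum.inr 0}, {Sum.inl 1, Sum.inl 3, Sum.inl 5, Sum.inr 1} })

end Sextic.Coordinates

end FaceCensus

/-- **(a) The rank-four face census for Galois CM fields of degree 6, 8, 12.**  For each of the eleven Galois CM closure types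
`(G, c)` of order `6`, `8`, `12` (§A.2): the Cayley table is a group with `c` a central involution `≠ 1` and is identified with the
named Mathlib group; the numbers of CM types / places / faces / type squares are as displayed (`8/3/48/6` at order `6`,
`16/4/192/24` at order `8`, `64/6/1920/240` at order `12`); EVERY face satisfies `SumTwo`, has four pairwise distinct CM-type
corners, and has no two complex-conjugate corners (no face class is a product of divisor classes); and the type squares form
exactly the displayed number of orbits under the Galois twists — `1` (order 6); `3, 4, 4, 6, 5, 3` (the six types of order 8);
`20, 22, 26, 20` (the four types of order 12) — with the displayed representatives and orbit sizes.  Together with the degree-`6`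
coordinate census (§A.3: one `k`-induced corner per face, the primitive corners a full packet, and the Weil plane of `B × E`). -/
def RankFourFaceCensus : Prop :=
  FaceCensus.Sextic.Coordinates.Census ∧ FaceCensus.Sextic.Cyclic.Census ∧
  (FaceCensus.Octic.Cyclic.Census ∧ FaceCensus.Octic.C4C2Square.Census ∧ FaceCensus.Octic.C4C2Nonsquare.Census ∧
    FaceCensus.Octic.Triquadratic.Census ∧ FaceCensus.Octic.Dihedral.Census ∧ FaceCensus.Octic.Quaternion.Census) ∧
  (FaceCensus.Duodecic.Cyclic.Census ∧ FaceCensus.Duodecic.C6C2.Census ∧ FaceCensus.Duodecic.Dihedral.Census ∧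
    FaceCensus.Duodecic.Dicyclic.Census)

/-! ## B.  The `μ`-table: archimedean slot exponents of a seesaw of four hermitian lines over a CM field

SETTING.  `L` a CM field with complex conjugation `x ↦ x̄` and a fixed non-zero purely imaginary element `δ` (`δ̄ = -δ`).  A SEESAW
DATUM is four hermitian LINES `W_i = (L, a_i x ȳ)`, `a_i ∈ (L⁺)^×` (`i = 0,…,3`), with an isometry of hermitian planes
`W₀ ⊕ W₁ ≅ W₂ ⊕ W₃` (a `GL₂(L)`-congruence `ḡᵀ · diag(a₀, a₁) · g = diag(a₂, a₃)`), as in the seesaw dual pairs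
`U(W_i) × U(V) ⊂ U(W) × U(V)` used with the theta correspondence for unitary groups (Gelbart–Rogawski 1991, §3; Kudla's seesaw
identity).  At an infinite place `w` of `L` each line is definite of sign `sign(re w(a_i))`.  The SLOT TABLE
`δ_S : (places of L) → ℤ` records the difference of the archimedean exponents of the characters attached to lines `1` and `0`:
`0` where `a₀, a₁` have the same sign at `w`, else `(±1)·(±3)` with `+1` iff line `1` is the positive one and `+3` iff `im w(δ) > 0`
(`slotDelta`); the RELABELLING BIT at `w` is set when `a₀` and `a₂` have opposite signs at `w` (`conjSwapAt`), and it splits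
`δ_S = δ₂ + δ₃` into the cross-plane tables `slotDelta₂` (bit set) and `slotDelta₃` (bit not set).  A `μ`-TABLE is any assignment
`μ : (seesaw data) → Fin 4 → (places of L) → ℤ` of integer exponents to the four slots; its SHARPENING `μ♯♯` keeps slot `0` and
re-sets slots `1, 2, 3` to `μ(0) + δ_S`, `μ(0) + δ₂`, `μ(0) + δ₃`.  The statement `MuTable` is the closed form of the sharpened
zero table `μ₀ := (0)♯♯ = (0, δ_S, δ₂, δ₃)`, the GAUGE identity `μ♯♯ = μ(0) + μ₀` for every `μ` (the slot-`0` entry is the only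
freedom), the FIXED-POINT identity `(μ♯♯)♯♯ = μ♯♯`, and the partition `δ₂ + δ₃ = δ_S`, `δ₂ · δ₃ = 0`. -/

noncomputable section

namespace MuTable

open NumberField

variable (L : Type) [Field L] [NumberField L] [NumberField.IsCMField L]

/-- **Seesaw datum**: four hermitian lines `W_i = (L, a_i x ȳ)` over the CM field `L` (`a_i` real, i.e. fixed by complex
conjugation, and non-zero) and an isometry `W₀ ⊕ W₁ ≅ W₂ ⊕ W₃`, rendered as a `GL₂(L)`-congruence of the diagonal Gram matrices. -/
structure SeesawDatum where
  /-- the four line discriminants -/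
  a : Fin 4 → L
  /-- each `a_i` lies in the maximal real subfield -/
  a_real : ∀ i, NumberField.IsCMField.complexConj L (a i) = a i
  /-- each `a_i` is non-zero -/
  a_ne : ∀ i, a i ≠ 0
  /-- `W₀ ⊕ W₁ ≅ W₂ ⊕ W₃`: `ḡᵀ · diag(a₀, a₁) · g = diag(a₂, a₃)` for some `g ∈ GL₂(L)` -/
  iso : ∃ g : GL (Fin 2) L,
    ((g : Matrix (Fin 2) (Fin 2) L).transpose.map (NumberField.IsCMField.complexConj L)) * Matrix.diagonal ![a 0, a 1] *
      (g : Matrix (Fin 2) (Fin 2) L) = Matrix.diagonal ![a 2, a 3]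

variable {L}

/-- The `W`-side discriminants `(a₀, a₁)` of the first plane. -/
def dW (S : SeesawDatum L) : Fin 2 → L := ![S.a 0, S.a 1]

/-- The discriminants `(a₂, a₃)` of the second plane. -/
def dW' (S : SeesawDatum L) : Fin 2 → L := ![S.a 2, S.a 3]

/-- **The slot table `δ_S : InfinitePlace L → ℤ`** (relative to the purely imaginary unit `δ`): `0` at a place where
`re w(a₀)`, `re w(a₁)` have the same sign; else `(+1 | −1) · (+3 | −3)`, `+1` iff line `1` is the positive one, `+3` iff
`0 < im w(δ)` (`w(·) = w.embedding`). -/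
noncomputable def slotDelta (δ : L) (S : SeesawDatum L) (w : InfinitePlace L) : ℤ :=
  if (0 < (w.embedding (dW S 0)).re ↔ 0 < (w.embedding (dW S 1)).re) then 0
  else (if 0 < (w.embedding (dW S 1)).re then 1 else -1) * (if 0 < (w.embedding δ).im then 3 else -3)

/-- **The relabelling bit at `w`**: the first letters `a₀`, `a₂` of the two planes have opposite signs through `w`. -/
def conjSwapAt (S : SeesawDatum L) (w : InfinitePlace L) : Prop :=
  ¬ ((0 < (w.embedding (dW S 0)).re) ↔ (0 < (w.embedding (dW' S 0)).re))

open scoped Classical in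
/-- `δ₂`: `slotDelta` at the places where the relabelling bit is set, `0` elsewhere. -/
noncomputable def slotDelta₂ (δ : L) (S : SeesawDatum L) (w : InfinitePlace L) : ℤ :=
  if conjSwapAt S w then slotDelta δ S w else 0

open scoped Classical in
/-- `δ₃`: `slotDelta` at the places where the relabelling bit is NOT set, `0` elsewhere. -/
noncomputable def slotDelta₃ (δ : L) (S : SeesawDatum L) (w : InfinitePlace L) : ℤ :=
  if conjSwapAt S w then 0 else slotDelta δ S w

/-- A `μ`-table over `L`: integer archimedean exponents of the four slots of every seesaw datum, place by place. -/
abbrev Table (L : Type) [Field L] [NumberField L] [NumberField.IsCMField L] : Type := SeesawDatum L → Fin 4 → InfinitePlace L → ℤ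

/-- **`μ♯`**: the table with entry `1` re-set to `μ S 0 + δ_S`. -/
noncomputable def muSharp (δ : L) (μ : Table L) (S : SeesawDatum L) : Fin 4 → InfinitePlace L → ℤ :=
  Function.update (μ S) 1 (μ S 0 + slotDelta δ S)

/-- **`μ♯♯`**: the table with entries `1, 2, 3` re-set to `μ S 0 + δ_S`, `μ S 0 + δ₂`, `μ S 0 + δ₃`. -/
noncomputable def muSharp₂₃ (δ : L) (μ : Table L) (S : SeesawDatum L) : Fin 4 → InfinitePlace L → ℤ :=
  Function.update (Function.update (muSharp δ μ S) 2 (μ S 0 + slotDelta₂ δ S)) 3 (μ S 0 + slotDelta₃ δ S)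

/-- **The zero slot table**: `μ S k w = 0` for all `S k w`. -/
def muSlotZero : Table L := fun _ _ _ => 0

end MuTable

/-- **(b) The `μ`-table.**  For every CM field `L`, every non-zero purely imaginary `δ ∈ L` and every seesaw datum `S` over `L`:
(1) CLOSED FORM — the sharpened zero table is `μ₀ S = (0, δ_S, δ₂, δ₃)` slot by slot; (2) GAUGE — for EVERY table `μ`,
`μ♯♯ S k = μ S 0 + μ₀ S k` (every sharpened table is `μ₀` shifted by its slot-`0` entry); (3) FIXED POINT — sharpening is
idempotent, `(μ♯♯)♯♯ = μ♯♯`, in particular `μ₀` is its own sharpening; (4) the cross-plane tables partition the slot table: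
`δ₂ + δ₃ = δ_S` and `δ₂ · δ₃ = 0` at every place. -/
def MuTable : Prop :=
  ∀ (L : Type) [Field L] [NumberField L] [NumberField.IsCMField L] (δ : L),
    NumberField.IsCMField.complexConj L δ = -δ → δ ≠ 0 → ∀ S : MuTable.SeesawDatum L,
      (∀ k : Fin 4, MuTable.muSharp₂₃ δ MuTable.muSlotZero S k =
          ![0, MuTable.slotDelta δ S, MuTable.slotDelta₂ δ S, MuTable.slotDelta₃ δ S] k) ∧
      (∀ (μ : MuTable.Table L) (k : Fin 4),
          MuTable.muSharp₂₃ δ μ S k = μ S 0 + MuTable.muSharp₂₃ δ MuTable.muSlotZero S k) ∧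
      (∀ μ : MuTable.Table L, MuTable.muSharp₂₃ δ (MuTable.muSharp₂₃ δ μ) S = MuTable.muSharp₂₃ δ μ S) ∧
      (∀ w : NumberField.InfinitePlace L,
          MuTable.slotDelta₂ δ S w + MuTable.slotDelta₃ δ S w = MuTable.slotDelta δ S w ∧
          MuTable.slotDelta₂ δ S w * MuTable.slotDelta₃ δ S w = 0)

/-! ## C.  The Hecke-translate wedge on the complex `2`-ball

The BALL MODEL of the complex hyperbolic plane: `U(2,1) = {g ∈ GL₃(ℂ) : gᴴ J g = J}`, `J = diag(1, 1, -1)`, acts on the unit ball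
`𝔹² = {z ∈ ℂ² : |z₀|² + |z₁|² < 1}` by the fractional-linear maps `g • z = ((g(z,1))₀, (g(z,1))₁) / (g(z,1))₂` (Jacobowitz, *An
Introduction to CR Structures*, AMS 1990, Ch. 2 §1; Rudin, *Function Theory in the Unit Ball of ℂⁿ*, Thm. 2.2.3), with
Jacobian `J_g(z) = ((g_{ij} w₂ − w_i g_{2j}) / w₂²)_{i,j<2}`, `w = g(z,1)`.  A cotangent field is `F : 𝔹² → ℂ²` (the `(1,0)`-form
`F₀ dz₀ + F₁ dz₁`); its pull-back (translate) by `γ` is `γ^*F = z ↦ J_γ(z)ᵀ F(γ z)`; the wedge of two covectors is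
`u ∧ v = u₀ v₁ − u₁ v₀`.  The statement: for a DENSE subgroup `Δ ≤ U(2,1)` and two continuous, not identically zero fields `F, G`,
some single translate `γ^*F`, `γ ∈ Δ`, has a non-zero wedge with `G` at some point.  On a compact ball quotient (a Picard modular
surface) with `Δ` the image of the rational points of the unitary group (dense by real approximation) and `F, G` the lifts of two
non-zero holomorphic one-forms, this is the pointwise core of the non-vanishing of `T_γ^* a ∧ a′` for a Hecke correspondence `T_γ`
— the holomorphic case of Clozel, J. reine angew. Math. 444 (1993) and Venkataramana, Compositio Math. 125 (2001), Thm. 8.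
The model (`J`, `U21`, `Ball`, `act`, `Jac`, `wedge`) is `BallModel.lean`. -/

/-- **(c) The Hecke-translate wedge.**  For every DENSE subgroup `Δ ≤ U(2,1)` and all continuous cotangent fields
`F, G : 𝔹² → ℂ²` that are not identically zero, there are `γ ∈ Δ` and `z ∈ 𝔹²` with `(γ^*F)(z) ∧ G(z) ≠ 0`, where
`(γ^*F)(z) = J_γ(z)ᵀ F(γ z)` is the pull-back of `F` along the fractional-linear action. -/
def HeckeTranslateWedge : Prop :=
  ∀ (Δ : Subgroup BallModel.U21), Dense (Δ : Set BallModel.U21) →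
    ∀ (F G : BallModel.Ball → (Fin 2 → ℂ)), Continuous F → Continuous G → F ≠ 0 → G ≠ 0 →
      ∃ γ ∈ Δ, ∃ z : BallModel.Ball,
        BallModel.wedge ((BallModel.Jac γ z).transpose.mulVec (F (BallModel.act γ z))) (G z) ≠ 0

end -- noncomputable section

end Summit.Ventures.HodgeRepro
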